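import Summits.QuantumFields.QCD.Theses.QuarksAsStableAction
import Summits.QuantumFields.QCD.Theses.WilsonQuarkChessboard
import Literature.MathematicalPhysics.QuantumLattice.WilsonDiracAP
import Literature.Probability.LatticeModels.TorusFourierProofs

/-!
# Stub `stub_apLatticeSum` of line `Sketch` (idea `free-tangent-landau-chessboard`)
(crux `Summit.QuantumFields.QCD.Theses.QuarksAsStableAction.WilsonQuarkStability`, item stmt-QuantumFields-9736,
route route-QuantumFields-QuarksAsStableAction)

**The antiperiodic `d = 4` lattice sum.**  For the squared symbol
`h(k) = (m + Σ_μ (1 − cos φ_μ))² + Σ_μ sin² φ_μ` of the free `r = 1` Wilson–Dirac operator with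
ANTIPERIODIC quarks on `(ℤ/L)⁴`, momenta `φ_μ = 2π k_μ/L + π/L = (2k_μ + 1)π/L`, we prove for `|m| ≤ 1/2`
and every `L ≥ 1`: `h(k) > 0` for all `k`, and `L⁻⁴ Σ_k 1/h(k) ≤ 16` (in fact `≤ 8`).

Proof (elementary, separable).
* Pointwise: with `a_μ = 1 − cos φ_μ ∈ [0, 2]`, `W = Σ a_μ`, `sin² φ_μ = 2a_μ − a_μ²`, one has
  `h − W = m² + (2m + 1) W + 2 Σ_{μ<ν} a_μ a_ν ≥ 0` for `m ≥ −1/2`, so `h ≥ W = 2 Σ_μ u_μ⁴` with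
  `u_μ = √(sin(φ_μ/2)) > 0` (`φ_μ/2 = (2k_μ+1)π/(2L) ∈ (0, π)`); AM–GM `4 u₀u₁u₂u₃ ≤ Σ u_μ⁴` gives
  `1/h ≤ (1/8) Π_μ u_μ⁻¹`, and `Σ_k Π_μ g(k_μ) = (Σ_j g j)⁴` (`Fintype.sum_pow`).
* Jordan (`Real.mul_le_sin`): `sin(nπ/(2L)) ≥ n/L` for `1 ≤ n ≤ L`; with `sin x = sin(π − x)` for the upper
  half of the grid, `u_j⁻¹ ≤ √L (1/√(2j+1) + 1/√(2(L−1−j)+1))`, and the reflection `j ↦ L − 1 − j` gives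
  `Σ_j u_j⁻¹ ≤ 2√L Σ_{j<L} 1/√(2j+1) ≤ 2√L √(2L)` by the telescoping `1/√(2j+1) ≤ √(2j+2) − √(2j)`.
* Assembly: `L⁻⁴ Σ_k 1/h ≤ L⁻⁴ (1/8) (2√L√(2L))⁴ = 8 ≤ 16`.

Pure theorem file (no definitions); leans on Mathlib only.
-/

namespace Summit.QuantumFields.QCD.Cruxes.WilsonQuarkStability.FreeTangentLandauChessboard

open Literature.MathematicalPhysics Literature.MathematicalPhysics.QuantumLattice
  Literature.MathematicalPhysics.QuantumFieldTheory Literature.Probability.LatticeModels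
open Matrix Complex
open scoped Kronecker ComplexOrder ComplexConjugate BigOperators

/-! ### Pointwise lower bound `h ≥ W` and AM–GM -/

/-- The algebraic core: for `m ≥ −1/2` and `a, b, c, d ≥ 0`,
`a + b + c + d ≤ (m + a + b + c + d)² + Σ (2x − x²)`. -/
private theorem apLatticeSum_alg (m a b c d : ℝ) (hm : -(1 / 2) ≤ m) (ha : 0 ≤ a) (hb : 0 ≤ b)
    (hc : 0 ≤ c) (hd : 0 ≤ d) :
    a + b + c + d ≤ (m + (a + b + c + d)) ^ 2 +
      ((2 * a - a ^ 2) + (2 * b - b ^ 2) + (2 * c - c ^ 2) + (2 * d - d ^ 2)) := by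
  nlinarith [mul_nonneg ha hb, mul_nonneg ha hc, mul_nonneg ha hd, mul_nonneg hb hc,
    mul_nonneg hb hd, mul_nonneg hc hd, sq_nonneg m,
    mul_nonneg (by linarith : (0 : ℝ) ≤ 2 * m + 1) (by linarith : 0 ≤ a + b + c + d)]

/-- `h ≥ W`: `Σ_μ (1 − cos θ_μ) ≤ (m + Σ_μ (1 − cos θ_μ))² + Σ_μ sin² θ_μ` for `m ≥ −1/2`. -/
private theorem apLatticeSum_h_ge (m : ℝ) (hm : -(1 / 2) ≤ m) (θ : Fin 4 → ℝ) :
    ∑ μ, (1 - Real.cos (θ μ)) ≤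
      (m + ∑ μ, (1 - Real.cos (θ μ))) ^ 2 + ∑ μ, Real.sin (θ μ) ^ 2 := by
  have hs : ∀ x : ℝ, Real.sin x ^ 2 = 2 * (1 - Real.cos x) - (1 - Real.cos x) ^ 2 := fun x => by
    rw [Real.sin_sq]; ring
  simp only [Fin.sum_univ_four, hs]
  exact apLatticeSum_alg m _ _ _ _ hm (sub_nonneg.2 (Real.cos_le_one _))
    (sub_nonneg.2 (Real.cos_le_one _)) (sub_nonneg.2 (Real.cos_le_one _))
    (sub_nonneg.2 (Real.cos_le_one _))

/-- AM–GM for four positive reals in reciprocal form: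
`1/(2(a⁴+b⁴+c⁴+d⁴)) ≤ (1/8) a⁻¹b⁻¹c⁻¹d⁻¹`. -/
private theorem apLatticeSum_amgm (a b c d : ℝ) (ha : 0 < a) (hb : 0 < b) (hc : 0 < c)
    (hd : 0 < d) :
    (2 * (a ^ 4 + b ^ 4 + c ^ 4 + d ^ 4))⁻¹ ≤ 1 / 8 * (a⁻¹ * b⁻¹ * c⁻¹ * d⁻¹) := by
  have key : 4 * (a * b * c * d) ≤ a ^ 4 + b ^ 4 + c ^ 4 + d ^ 4 := by
    nlinarith [sq_nonneg (a ^ 2 - b ^ 2), sq_nonneg (c ^ 2 - d ^ 2), sq_nonneg (a * b - c * d),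
      mul_pos ha hb, mul_pos hc hd]
  have hp : 0 < a * b * c * d := by positivity
  rw [show 1 / 8 * (a⁻¹ * b⁻¹ * c⁻¹ * d⁻¹) = (8 * (a * b * c * d))⁻¹ by
    rw [mul_inv, mul_inv, mul_inv, mul_inv, one_div]]
  exact inv_anti₀ (by positivity) (by linarith)

/-- **Pointwise bound.**  If all `sin(θ_μ/2) > 0` and `|m| ≤ 1/2` then `h(θ) > 0` and
`h(θ)⁻¹ ≤ (1/8) Π_μ (√(sin(θ_μ/2)))⁻¹`. -/
private theorem apLatticeSum_pointwise (m : ℝ) (hm : |m| ≤ 1 / 2) (θ : Fin 4 → ℝ)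
    (hθ : ∀ μ, 0 < Real.sin (θ μ / 2)) :
    0 < (m + ∑ μ, (1 - Real.cos (θ μ))) ^ 2 + ∑ μ, Real.sin (θ μ) ^ 2 ∧
    ((m + ∑ μ, (1 - Real.cos (θ μ))) ^ 2 + ∑ μ, Real.sin (θ μ) ^ 2)⁻¹ ≤
      1 / 8 * ∏ μ, (Real.sqrt (Real.sin (θ μ / 2)))⁻¹ := by
  have hge := apLatticeSum_h_ge m (by have := (abs_le.1 hm).1; linarith) θ
  have hu : ∀ μ, 1 - Real.cos (θ μ) = 2 * Real.sqrt (Real.sin (θ μ / 2)) ^ 4 := fun μ => by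
    rw [show Real.sqrt (Real.sin (θ μ / 2)) ^ 4 = (Real.sqrt (Real.sin (θ μ / 2)) ^ 2) ^ 2 by ring,
      Real.sq_sqrt (hθ μ).le, Real.sin_sq_eq_half_sub, show 2 * (θ μ / 2) = θ μ by ring]
    ring
  have hW : ∑ μ, (1 - Real.cos (θ μ)) = 2 * (Real.sqrt (Real.sin (θ 0 / 2)) ^ 4 +
      Real.sqrt (Real.sin (θ 1 / 2)) ^ 4 + Real.sqrt (Real.sin (θ 2 / 2)) ^ 4 +
      Real.sqrt (Real.sin (θ 3 / 2)) ^ 4) := by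
    simp only [Fin.sum_univ_four, hu]
    ring
  have hpos : ∀ μ, 0 < Real.sqrt (Real.sin (θ μ / 2)) := fun μ => Real.sqrt_pos.2 (hθ μ)
  have hWpos : 0 < ∑ μ, (1 - Real.cos (θ μ)) := by
    rw [hW]
    linarith [pow_pos (hpos 0) 4, pow_pos (hpos 1) 4, pow_pos (hpos 2) 4, pow_pos (hpos 3) 4]
  refine ⟨lt_of_lt_of_le hWpos hge, (inv_anti₀ hWpos hge).trans ?_⟩
  rw [hW, Fin.prod_univ_four]
  exact apLatticeSum_amgm _ _ _ _ (hpos 0) (hpos 1) (hpos 2) (hpos 3)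

/-! ### Jordan's inequality on the antiperiodic grid -/

/-- Jordan: for `1 ≤ n ≤ L`, `sin(nπ/(2L)) ≥ n/L > 0`, hence `(√(sin(nπ/(2L))))⁻¹ ≤ √L/√n`. -/
private theorem apLatticeSum_jordan (n L : ℕ) (hn : 1 ≤ n) (hnL : n ≤ L) :
    0 < Real.sin ((n : ℝ) * Real.pi / (2 * L)) ∧
    (Real.sqrt (Real.sin ((n : ℝ) * Real.pi / (2 * L))))⁻¹ ≤ Real.sqrt L * (1 / Real.sqrt n) := by
  have hL : (0 : ℝ) < L := by exact_mod_cast (show 0 < L by omega)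
  have hn' : (0 : ℝ) < n := by exact_mod_cast (show 0 < n by omega)
  have hq : 0 < (n : ℝ) / L := div_pos hn' hL
  have hq1 : (n : ℝ) / L ≤ 1 := by rw [div_le_one hL]; exact_mod_cast hnL
  have hx : (n : ℝ) * Real.pi / (2 * L) = (n : ℝ) / L * (Real.pi / 2) := by ring
  have hx0 : 0 ≤ (n : ℝ) / L * (Real.pi / 2) := by positivity
  have hx1 : (n : ℝ) / L * (Real.pi / 2) ≤ Real.pi / 2 := by
    calc (n : ℝ) / L * (Real.pi / 2) ≤ 1 * (Real.pi / 2) :=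
          mul_le_mul_of_nonneg_right hq1 (by positivity)
      _ = Real.pi / 2 := one_mul _
  have hkey : 2 / Real.pi * (Real.pi / 2) = 1 := by
    rw [div_mul_div_comm, mul_comm Real.pi 2, div_self (by positivity : (2 : ℝ) * Real.pi ≠ 0)]
  have hsin : (n : ℝ) / L ≤ Real.sin ((n : ℝ) * Real.pi / (2 * L)) := by
    have h := Real.mul_le_sin hx0 hx1
    rw [mul_left_comm, hkey, mul_one, ← hx] at h
    exact h
  refine ⟨hq.trans_le hsin, ?_⟩
  calc (Real.sqrt (Real.sin ((n : ℝ) * Real.pi / (2 * L))))⁻¹ ≤ (Real.sqrt ((n : ℝ) / L))⁻¹ :=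
        inv_anti₀ (Real.sqrt_pos.2 hq) (Real.sqrt_le_sqrt hsin)
    _ = Real.sqrt L * (1 / Real.sqrt n) := by
        rw [Real.sqrt_div' _ hL.le, inv_div, div_eq_mul_one_div]

/-- **Per-coordinate bound** on the antiperiodic grid `φ_v = 2πv/L + π/L`, `v < L`:
`sin(φ_v/2) > 0` and `(√(sin(φ_v/2)))⁻¹ ≤ √L (1/√(2v+1) + 1/√(2(L−1−v)+1))`. -/
private theorem apLatticeSum_coord (v L : ℕ) (hv : v < L) :
    0 < Real.sin ((2 * Real.pi * (v : ℝ) / L + Real.pi / L) / 2) ∧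
    (Real.sqrt (Real.sin ((2 * Real.pi * (v : ℝ) / L + Real.pi / L) / 2)))⁻¹ ≤
      Real.sqrt L * (1 / Real.sqrt (2 * (v : ℝ) + 1) +
        1 / Real.sqrt (2 * ((L - 1 - v : ℕ) : ℝ) + 1)) := by
  have hL : (0 : ℝ) < L := by exact_mod_cast (show 0 < L by omega)
  have hL0 : (L : ℝ) ≠ 0 := hL.ne'
  obtain ⟨w, hw⟩ : ∃ w, v + w + 1 = L := ⟨L - v - 1, by omega⟩
  have hw' : L - 1 - v = w := by omega
  have hwr : (w : ℝ) = L - v - 1 := by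
    have h : ((v + w + 1 : ℕ) : ℝ) = L := by exact_mod_cast hw
    push_cast at h
    linarith
  have hx : (2 * Real.pi * (v : ℝ) / L + Real.pi / L) / 2 =
      ((2 * v + 1 : ℕ) : ℝ) * Real.pi / (2 * L) := by
    push_cast
    field_simp
  have hy : Real.pi - ((2 * v + 1 : ℕ) : ℝ) * Real.pi / (2 * L) =
      ((2 * w + 1 : ℕ) : ℝ) * Real.pi / (2 * L) := by
    push_cast
    rw [hwr]
    field_simp
    ring
  rw [hx, hw']
  have ha : 0 ≤ 1 / Real.sqrt (2 * (v : ℝ) + 1) := by positivity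
  have hb : 0 ≤ 1 / Real.sqrt (2 * (w : ℝ) + 1) := by positivity
  have hsL : 0 ≤ Real.sqrt L := Real.sqrt_nonneg _
  rcases le_or_gt (2 * v + 1) L with h1 | h1
  · refine ⟨(apLatticeSum_jordan _ _ (by omega) h1).1, ?_⟩
    calc _ ≤ Real.sqrt L * (1 / Real.sqrt ((2 * v + 1 : ℕ) : ℝ)) :=
          (apLatticeSum_jordan _ _ (by omega) h1).2
      _ = Real.sqrt L * (1 / Real.sqrt (2 * (v : ℝ) + 1)) := by norm_num
      _ ≤ _ := mul_le_mul_of_nonneg_left (le_add_of_nonneg_right hb) hsL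
  · have h2 : 2 * w + 1 ≤ L := by omega
    rw [← Real.sin_pi_sub, hy]
    refine ⟨(apLatticeSum_jordan _ _ (by omega) h2).1, ?_⟩
    calc _ ≤ Real.sqrt L * (1 / Real.sqrt ((2 * w + 1 : ℕ) : ℝ)) :=
          (apLatticeSum_jordan _ _ (by omega) h2).2
      _ = Real.sqrt L * (1 / Real.sqrt (2 * (w : ℝ) + 1)) := by norm_num
      _ ≤ _ := mul_le_mul_of_nonneg_left (le_add_of_nonneg_left ha) hsL

/-! ### The one-dimensional sum -/

/-- Telescoping: `Σ_{v<N} 1/√(2v+1) ≤ √(2N)` (from `1/√(2v+1) ≤ √(2v+2) − √(2v)`). -/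
private theorem apLatticeSum_telescope (N : ℕ) :
    ∑ v ∈ Finset.range N, 1 / Real.sqrt (2 * (v : ℝ) + 1) ≤ Real.sqrt (2 * N) := by
  induction N with
  | zero => simp
  | succ n ih =>
    rw [Finset.sum_range_succ]
    push_cast
    have ha : 0 ≤ Real.sqrt (2 * n) := Real.sqrt_nonneg _
    have hb : 0 < Real.sqrt (2 * n + 1) := Real.sqrt_pos.2 (by positivity)
    have hc : 0 < Real.sqrt (2 * (n + 1)) := Real.sqrt_pos.2 (by positivity)
    have ha2 : Real.sqrt (2 * n) ^ 2 = 2 * n := Real.sq_sqrt (by positivity)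
    have hb2 : Real.sqrt (2 * n + 1) ^ 2 = 2 * n + 1 := Real.sq_sqrt (by positivity)
    have hc2 : Real.sqrt (2 * (n + 1)) ^ 2 = 2 * (n + 1) := Real.sq_sqrt (by positivity)
    have hac : Real.sqrt (2 * n) ≤ Real.sqrt (2 * (n + 1)) := Real.sqrt_le_sqrt (by linarith)
    have h1 : Real.sqrt (2 * (n + 1)) + Real.sqrt (2 * n) ≤ 2 * Real.sqrt (2 * n + 1) := by
      nlinarith [sq_nonneg (Real.sqrt (2 * n) - Real.sqrt (2 * (n + 1)))]
    have h2 : (Real.sqrt (2 * (n + 1)) - Real.sqrt (2 * n)) *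
        (Real.sqrt (2 * (n + 1)) + Real.sqrt (2 * n)) = 2 := by
      linear_combination hc2 - ha2
    have key : 1 / Real.sqrt (2 * n + 1) ≤ Real.sqrt (2 * (n + 1)) - Real.sqrt (2 * n) := by
      rw [div_le_iff₀ hb]
      nlinarith [mul_le_mul_of_nonneg_left h1 (sub_nonneg.2 hac)]
    linarith

/-- Reindexing a sum over `ZMod L` by `val : ZMod L → {0, …, L−1}`. -/
private theorem apLatticeSum_sum_val (L : ℕ) [NeZero L] (F : ℕ → ℝ) :
    ∑ j : ZMod L, F j.val = ∑ v ∈ Finset.range L, F v :=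
  Finset.sum_nbij' ZMod.val (fun v : ℕ => (v : ZMod L))
    (fun j _ => Finset.mem_range.2 (ZMod.val_lt j)) (fun _ _ => Finset.mem_univ _)
    (fun j _ => ZMod.natCast_zmod_val j)
    (fun _ hv => ZMod.val_cast_of_lt (Finset.mem_range.1 hv)) fun _ _ => rfl

/-- **The one-dimensional bound**: `Σ_{j ∈ ℤ/L} (√(sin(φ_j/2)))⁻¹ ≤ 2√L√(2L)`. -/
private theorem apLatticeSum_oneDim (L : ℕ) [NeZero L] :
    ∑ j : ZMod L, (Real.sqrt (Real.sin ((2 * Real.pi * (j.val : ℝ) / L + Real.pi / L) / 2)))⁻¹ ≤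
      2 * Real.sqrt L * Real.sqrt (2 * L) := by
  have hsL : 0 ≤ Real.sqrt L := Real.sqrt_nonneg _
  have hrefl : ∑ v ∈ Finset.range L, 1 / Real.sqrt (2 * ((L - 1 - v : ℕ) : ℝ) + 1) =
      ∑ v ∈ Finset.range L, 1 / Real.sqrt (2 * (v : ℝ) + 1) :=
    Finset.sum_range_reflect (fun v => 1 / Real.sqrt (2 * (v : ℝ) + 1)) L
  calc ∑ j : ZMod L, (Real.sqrt (Real.sin ((2 * Real.pi * (j.val : ℝ) / L + Real.pi / L) / 2)))⁻¹
      ≤ ∑ j : ZMod L, Real.sqrt L * (1 / Real.sqrt (2 * (j.val : ℝ) + 1) +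
          1 / Real.sqrt (2 * ((L - 1 - j.val : ℕ) : ℝ) + 1)) :=
        Finset.sum_le_sum fun j _ => (apLatticeSum_coord j.val L (ZMod.val_lt j)).2
    _ = Real.sqrt L * ∑ v ∈ Finset.range L, (1 / Real.sqrt (2 * (v : ℝ) + 1) +
          1 / Real.sqrt (2 * ((L - 1 - v : ℕ) : ℝ) + 1)) := by
        rw [← Finset.mul_sum]
        congr 1
        exact apLatticeSum_sum_val L fun v => 1 / Real.sqrt (2 * (v : ℝ) + 1) +
          1 / Real.sqrt (2 * ((L - 1 - v : ℕ) : ℝ) + 1)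
    _ = Real.sqrt L * (2 * ∑ v ∈ Finset.range L, 1 / Real.sqrt (2 * (v : ℝ) + 1)) := by
        rw [Finset.sum_add_distrib, hrefl]
        ring
    _ ≤ Real.sqrt L * (2 * Real.sqrt (2 * L)) :=
        mul_le_mul_of_nonneg_left (mul_le_mul_of_nonneg_left (apLatticeSum_telescope L)
          (by norm_num)) hsL
    _ = 2 * Real.sqrt L * Real.sqrt (2 * L) := by ring

/-! ### Assembly -/

/-- **Separable assembly**: if `H(k)⁻¹ ≤ (1/8) Π_μ g(k_μ)` with `g ≥ 0` and `Σ_j g j ≤ 2√L√(2L)`, then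
`L⁻⁴ Σ_k H(k)⁻¹ ≤ 16` (indeed `≤ 8`), by `Σ_k Π_μ g(k_μ) = (Σ_j g j)⁴`. -/
private theorem apLatticeSum_assemble (L : ℕ) [NeZero L] (H : TorusSite 4 L → ℝ) (g : ZMod L → ℝ)
    (hH : ∀ k, (H k)⁻¹ ≤ 1 / 8 * ∏ μ, g (k μ))
    (hg : ∑ j, g j ≤ 2 * Real.sqrt L * Real.sqrt (2 * L)) (hg0 : ∀ j, 0 ≤ g j) :
    ((L : ℝ) ^ 4)⁻¹ * ∑ k, (H k)⁻¹ ≤ 16 := by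
  have hL : (0 : ℝ) < L := by exact_mod_cast Nat.pos_of_ne_zero (NeZero.ne L)
  have hsep : ∑ k : TorusSite 4 L, ∏ μ, g (k μ) = (∑ j, g j) ^ 4 := (Fintype.sum_pow g 4).symm
  have hs0 : 0 ≤ ∑ j, g j := Finset.sum_nonneg fun j _ => hg0 j
  have h1 : Real.sqrt L ^ 4 = (L : ℝ) ^ 2 :=
    calc Real.sqrt L ^ 4 = (Real.sqrt L ^ 2) ^ 2 := by ring
      _ = (L : ℝ) ^ 2 := by rw [Real.sq_sqrt hL.le]
  have h2 : Real.sqrt (2 * L) ^ 4 = (2 * (L : ℝ)) ^ 2 :=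
    calc Real.sqrt (2 * L) ^ 4 = (Real.sqrt (2 * L) ^ 2) ^ 2 := by ring
      _ = (2 * (L : ℝ)) ^ 2 := by rw [Real.sq_sqrt (by positivity)]
  calc ((L : ℝ) ^ 4)⁻¹ * ∑ k, (H k)⁻¹
      ≤ ((L : ℝ) ^ 4)⁻¹ * ∑ k : TorusSite 4 L, (1 / 8 * ∏ μ, g (k μ)) := by
        gcongr with k
        exact hH k
    _ = ((L : ℝ) ^ 4)⁻¹ * (1 / 8 * (∑ j, g j) ^ 4) := by rw [← Finset.mul_sum, hsep]
    _ ≤ ((L : ℝ) ^ 4)⁻¹ * (1 / 8 * (2 * Real.sqrt L * Real.sqrt (2 * L)) ^ 4) :=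
        mul_le_mul_of_nonneg_left (mul_le_mul_of_nonneg_left (pow_le_pow_left₀ hs0 hg 4)
          (by norm_num)) (by positivity)
    _ = 8 := by
        rw [mul_pow, mul_pow, h1, h2, inv_mul_eq_iff_eq_mul₀ (pow_ne_zero 4 hL.ne')]
        ring
    _ ≤ 16 := by norm_num

/-- **Stub 2 (`stub_apLatticeSum`, the antiperiodic `d = 4` lattice sum).**  For the squared symbol
`h(k) = (m + Σ_μ (1 − cos φ_μ))² + Σ_μ sin² φ_μ` of the free Wilson–Dirac operator with antiperiodic
quarks, `φ_μ = (2k_μ + 1)π/L`, and `|m| ≤ 1/2`: `h(k) > 0` for every `k ∈ (ℤ/L)⁴` and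
`L⁻⁴ Σ_k 1/h(k) ≤ 16`, uniformly in `L ≥ 1`.  Proof: `h ≥ Σ_μ (1 − cos φ_μ) = 2 Σ_μ sin²(φ_μ/2) > 0`
(`φ_μ/2 ∈ (0, π)`), AM–GM separation `1/h ≤ (1/8) Π_μ (√ sin(φ_μ/2))⁻¹`, Jordan's inequality
`sin((2j+1)π/(2L)) ≥ min(2j+1, 2L−2j−1)/L` and the telescoping sum `Σ_{j<L} (2j+1)^{-1/2} ≤ √(2L)` give
`L⁻⁴ Σ_k 1/h ≤ (1/8) L⁻⁴ (2√L√(2L))⁴ = 8`. -/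
theorem stub_apLatticeSum :
  ∀ (L : ℕ) [NeZero L] (m : ℝ), |m| ≤ 1 / 2 →
    let φ : TorusSite 4 L → Fin 4 → ℝ := fun k μ => 2 * Real.pi * ((k μ).val : ℝ) / L + Real.pi / L
    let h : TorusSite 4 L → ℝ := fun k =>
      (m + ∑ μ, (1 - Real.cos (φ k μ))) ^ 2 + ∑ μ, Real.sin (φ k μ) ^ 2
    (∀ k, 0 < h k) ∧ ((L : ℝ) ^ 4)⁻¹ * ∑ k, (h k)⁻¹ ≤ 16 := by
  intro L _ m hm φ h
  have hpt : ∀ k : TorusSite 4 L, 0 < h k ∧ (h k)⁻¹ ≤ 1 / 8 * ∏ μ,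
      (Real.sqrt (Real.sin ((2 * Real.pi * (((k μ).val : ℕ) : ℝ) / L + Real.pi / L) / 2)))⁻¹ :=
    fun k => apLatticeSum_pointwise m hm (φ k)
      fun μ => (apLatticeSum_coord (k μ).val L (ZMod.val_lt _)).1
  exact ⟨fun k => (hpt k).1, apLatticeSum_assemble L h
    (fun j => (Real.sqrt (Real.sin ((2 * Real.pi * ((j.val : ℕ) : ℝ) / L + Real.pi / L) / 2)))⁻¹)
    (fun k => (hpt k).2) (apLatticeSum_oneDim L) fun _ => inv_nonneg.2 (Real.sqrt_nonneg _)⟩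

end Summit.QuantumFields.QCD.Cruxes.WilsonQuarkStability.FreeTangentLandauChessboard
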